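import Summits.BirchSwinnertonDyer.BirchSwinnertonDyer.Theorems.GenusKolyvaginAtTwoPowDvdShaCardAtTwoRTLocalEigenDualityAtKolyvaginPlace
import Summits.BirchSwinnertonDyer.BirchSwinnertonDyer.Theorems.GenusKolyvaginAtTwoPowDvdShaCardAtTwoRTCommonOwnPrimeVanishing
import Summits.BirchSwinnertonDyer.BirchSwinnertonDyer.Theorems.GenusKolyvaginAtTwoPowDvdShaCardAtTwoRTTwoTermIdentity
import Summits.BirchSwinnertonDyer.BirchSwinnertonDyer.Theorems.ByReductionTypeAtTwoRankOneAtTwoBigImageOddLocalOneDoorBottomLemma43AtTwo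
import Summits.BirchSwinnertonDyer.BirchSwinnertonDyer.Theorems.GenusKolyvaginAtTwoKolyvaginRelationAtTwoHeegnerInputs
import Summits.BirchSwinnertonDyer.BirchSwinnertonDyer.Theorems.Rank1ResidualJetWeilDatumConj
import Literature.NumberTheory.GaloisCohomology.LocalInvariantMapConjCompatible
import HarnessLib

/-!
# Route `GenusKolyvaginAtTwo`, crux L_T `PowDvdShaCardAtTwoRT` (stmt-BirchSwinnertonDyer-23242), LINE 18 stub KS, the DROPS, input `hrec` —
# KOLYVAGIN'S TWO-TERM IDENTITY AT `p = 2` OVER THE HEEGNER FIELD, IN KOLYVAGIN-DATUM CURRENCY (the wrapper of memo §2)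

Seat `bsd-line-gk2-p3` g23 (PROVER seat 3/3, cell `bsd-f1-sign2`), `--supports stmt-BirchSwinnertonDyer-23242` (helper; closes nothing).
THEOREMS ONLY (no definition, no named fact, no `sorry`).  BSD is NOT proved by any of this; neither is the crux nor any stub.

WHAT.  Kolyvagin, Math. Ann. 291 (1991) Thm. 2.1 — the input `hrec` of gk2-p2's `PlusDescent.weakSwapOracle_of_twoPrimeReciprocity`
(`…RTTwoPrimeSwapWeak`) — for the swap `ℓ₀ ↦ ℓ′` of a square-free product `n` of Kolyvagin primes at `2` (all of index `≥ M + 1`,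
margin one), on the route's frame (`E/ℚ` globally minimal with `Δ < 0`, odd Tamagawa product, `2`-adic tower onto; `K` imaginary
quadratic with `d_K < −4` and the Heegner hypothesis; `τ` the non-trivial automorphism of `K`).  With `x = c_M(nℓ′)`, `y = c_M(nℓ₀)`
(the tree's `KolyvaginHeegnerData.kolyvaginClass` at `p = 2`), SAME `τ`-sign `ε`, and the four local exponents
«`2^j loc_{λ′} y = 0 ⟺ A′ ≤ j`», «`2^j loc_{λ′} x` Kummer `⟺ B′ ≤ j`», «`2^j loc_{λ₀} x = 0 ⟺ A₀ ≤ j`», «`2^j loc_{λ₀} y` Kummer `⟺ B₀ ≤ j`»: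
**`M + 2 ≤ A′ + B′ ⟹ A′ + B′ = A₀ + B₀`** (`exponent_add_eq_of_kolyvagin_twoTerm`).  In the DROPS' currency
(`d_T(ℓ) = M −` exponent): `A′ = M − d_S(ℓ′)`, `B′ = M − d_{S∖ℓ₀}(ℓ′)` (Q2 at the own prime `ℓ′` of `nℓ′`), `A₀ = M − d_{S′}(ℓ₀)`,
`B₀ = M − d_{S∖ℓ₀}(ℓ₀)`, and `…RTTwoTermIdentity.dl_add_eq_of_twoTerm` / `guard_of_dl_add_two_le` translate.

HOW (memo `Cruxes/PowDvdShaCardAtTwoRT/Lines/plus-descent-hrec-gk2p3.md` §2, every piece a kernel theorem of this seat's files):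
the Poitou–Tate sum of THE canonical invariant family over `T = {λ′, λ₀} ∪ {places over n}` for the pair `(x, y)`:
* off `T` both classes are Kummer — Gross 6.2(1) at `2` (`RankOneAtTwoOneDoor.kolyvaginClass_two_mem_selmerLocalKer_of_odd_tamagawaProduct`)
  at the finite places, `selmerLocalKer_eq_top_of_isAlgClosed` at the complex ones (`kolyvaginClass_two_mem_kummerOutside`);
* at the places over `n` (COMMON own primes) the local term vanishes (`…RTCommonOwnPrimeVanishing`, margin one, unconditional);
* at `λ′` and `λ₀` the terms have orders `2^(A′+B′−(M+1))`, `2^(A₀+B₀−(M+1))` (`…RTLocalEigenDualityAtKolyvaginPlace`, the Weil datum from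
  `JET.GlobalDuality.exists_weilPairing_liftEquivariant`, THE canonical family: `canonical_isPerfect`, `isConjCompatible_canonical`);
* `…RTTwoTermIdentity.exponent_eq_of_twoTerm_canonical` concludes.
§4 restates it in Q2's currency (`exponent_add_eq_of_kolyvagin_twoTerm_localKer`: thresholds of the GLOBAL classes `2^j • c_M(·)` in
`torsionLocalKer` / `selmerLocalKer` at `K_λ`, dictionaries `pow_zsmul_mem_torsionLocalKer_iff`, `pow_zsmul_mem_selmerLocalKer_iff`).
Displayed inputs left to the KS assembler: the sign clauses (`sign_conjAct_kolyvaginClass_two`), the four exponents (Q2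
`KolyvaginRelationAtTwo` + the definition of `d_T`), `FrobEqFrobInfty W K (2^M)` at `ℓ′, ℓ₀` (gk2-p5 `…RTGrossLevelAtTwo`).

References: [Kolyvagin1991MathAnn] Thm. 2.1; [McCallumLMS1991] §5 Lemma 5.3 and (13); [GrossLMS1991] Prop. 6.2 (1), §3;
[MilneADT2006] I Thm. 4.10(b), Cor. 2.3.
-/

set_option autoImplicit false

noncomputable section

open scoped Classical
open Function Field NumberField IsDedekindDomain WeierstrassCurve
open Literature.NumberTheory.EllipticCurves Literature.NumberTheory.EllipticCurves.ModularForms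
open Literature.NumberTheory.EllipticCurves.Jetchev2008
open Literature.NumberTheory.EllipticCurves.RingClassField
open Literature.NumberTheory.GaloisRepresentations Literature.NumberTheory.GaloisCohomology
open Literature.NumberTheory.Automorphic
open Summit.BirchSwinnertonDyer.Rank1Residual
open Summit.BirchSwinnertonDyer.Rank1Residual.X11b.Relaxation
open Summit.BirchSwinnertonDyer.Rank1Residual.X11b.KummerPT
open Summit.BirchSwinnertonDyer.Rank1Residual.JET.GlobalDuality
open Summit.BirchSwinnertonDyer.Rank1Residual.JET.SelmerVocabulary

-- the Theorems namespace of this sub repeats the summit name by design (D-0017 nested layout)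
set_option linter.dupNamespace false

namespace Summit.BirchSwinnertonDyer.BirchSwinnertonDyer.Theorems.GenusExact.PlusDescent

variable (W : WeierstrassCurve ℚ) [W.IsElliptic] [W.IsGloballyMinimal] [NeZero (W.conductorNorm ℤ)]
  (K : Type) [Field K] [NumberField K]

/-! ## §1 Kolyvagin's class is Kummer off its conductor (Gross 6.2(1) at `2`, Selmer-structure currency) -/

/-- **`loc_v c_M(c)` lies in the Kummer condition at every finite `v ∤ c`** (Gross 6.2(1) at `2`, odd Tamagawa product — the tree's
`RankOneAtTwoOneDoor.kolyvaginClass_two_mem_selmerLocalKer_of_odd_tamagawaProduct` — read through `comap_localization_kummerSelmerStructure`).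
[cite: GrossLMS1991, Prop. 6.2 (1)] -/
theorem localization_kolyvaginClass_two_mem_kummerSelmerStructure
    (hsurj : ∀ k : ℕ, W.HasSurjectiveModNGaloisRep ((2 ^ k : ℕ) : ℤ)) (hc : Odd W.tamagawaProduct)
    (hK : IsImaginaryQuadratic K) (hD3 : NumberField.discr K ≠ -3) (hD4 : NumberField.discr K ≠ -4)
    (hH : SatisfiesHeegnerHypothesis (W.conductorNorm ℤ) K)
    (Dt : ModularParametrizationData W (W.conductorNorm ℤ)) (β : ℤ) (ι : K →+* ℂ) (M : ℕ)
    {c : ℕ} (hcs : Squarefree c)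
    (hk : ∀ q ∈ c.primeFactors, Zhang2014.IsKolyvaginPrime (W.conductorNorm ℤ) W K 2 q ∧ M ≤ Zhang2014.kolyvaginIndex W 2 q)
    (d : KolyvaginHeegnerData Dt β ι c) (v : HeightOneSpectrum (𝓞 K)) (hv : (c : 𝓞 K) ∉ v.asIdeal) :
    galoisCohomology.localization ((W.baseChange K).torsionGaloisModule ((2 ^ M : ℕ) : ℤ)) (Sum.inr v : Place K) 1
        (d.kolyvaginClass Nat.prime_two M) ∈
      (W.baseChange K).kummerSelmerStructure ((2 ^ M : ℕ) : ℤ) (Sum.inr v) := by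
  have key : d.kolyvaginClass Nat.prime_two M ∈
      selmerLocalKer (W.baseChange K) (Place.Completion (Sum.inr v : Place K)) ((2 ^ M : ℕ) : ℤ) := by
    rw [selmerLocalKer_completion_inr]
    exact RankOneAtTwoOneDoor.kolyvaginClass_two_mem_selmerLocalKer_of_odd_tamagawaProduct W hsurj hc K hK hD3 hD4 hH
      Dt β ι M hcs hk d v hv
  exact AddSubgroup.mem_comap.mp ((SetLike.ext_iff.mp
    ((W.baseChange K).comap_localization_kummerSelmerStructure ((2 ^ M : ℕ) : ℤ) (Sum.inr v : Place K)) _).mpr key)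

/-- **`c_M(c) ∈ H¹(G_T, E[2^M])` with Kummer conditions off `T`** for every `T` containing the places over `c`: off `T` a finite place does
not divide `c` (Gross 6.2(1) at `2`), and at a complex place the condition is empty (`K` imaginary quadratic).
[cite: GrossLMS1991, Prop. 6.2 (1)] [cite: MilneADT2006, Ch. I §6, (6.5)] -/
theorem kolyvaginClass_two_mem_kummerOutside
    (hsurj : ∀ k : ℕ, W.HasSurjectiveModNGaloisRep ((2 ^ k : ℕ) : ℤ)) (hc : Odd W.tamagawaProduct)
    (hK : IsImaginaryQuadratic K) (hD3 : NumberField.discr K ≠ -3) (hD4 : NumberField.discr K ≠ -4)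
    (hH : SatisfiesHeegnerHypothesis (W.conductorNorm ℤ) K)
    (Dt : ModularParametrizationData W (W.conductorNorm ℤ)) (β : ℤ) (ι : K →+* ℂ) (M : ℕ)
    {c : ℕ} (hcs : Squarefree c)
    (hk : ∀ q ∈ c.primeFactors, Zhang2014.IsKolyvaginPrime (W.conductorNorm ℤ) W K 2 q ∧ M ≤ Zhang2014.kolyvaginIndex W 2 q)
    (d : KolyvaginHeegnerData Dt β ι c) (T : Finset (Place K))
    (hT : ∀ v : HeightOneSpectrum (𝓞 K), (c : 𝓞 K) ∈ v.asIdeal → (Sum.inr v : Place K) ∈ T) :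
    d.kolyvaginClass Nat.prime_two M ∈ kummerOutside (W.baseChange K) (2 ^ M) T := by
  refine (mem_kummerOutside_iff (W.baseChange K) (2 ^ M) T _).mpr fun v hv ↦ ?_
  have key : d.kolyvaginClass Nat.prime_two M ∈
      selmerLocalKer (W.baseChange K) (Place.Completion v) ((2 ^ M : ℕ) : ℤ) := by
    rcases v with w | v
    · rw [selmerLocalKer_completion_inl]
      haveI : IsAlgClosed w.Completion :=
        isAlgClosed_of_ringEquiv (InfinitePlace.Completion.ringEquivComplexOfIsComplex (hK.2.isComplex w)).symm
      rw [WeierstrassCurve.selmerLocalKer_eq_top_of_isAlgClosed]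
      trivial
    · rw [selmerLocalKer_completion_inr]
      exact RankOneAtTwoOneDoor.kolyvaginClass_two_mem_selmerLocalKer_of_odd_tamagawaProduct W hsurj hc K hK hD3 hD4 hH
        Dt β ι M hcs hk d v (fun h ↦ hv (hT v h))
  exact AddSubgroup.mem_comap.mp ((SetLike.ext_iff.mp
    ((W.baseChange K).comap_localization_kummerSelmerStructure ((2 ^ M : ℕ) : ℤ) v) _).mpr key)

/-! ## §2 The place of a Kolyvagin prime is `τ`-fixed -/

omit [W.IsElliptic] [NeZero (W.conductorNorm ℤ)] in
/-- **`τ • λ = λ`** for the place `λ ∋ ℓ` of an inert (Zhang–)Kolyvagin prime: `τ` fixes `ℓ`, so `τ • λ ∋ ℓ`, and `λ` is the only place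
above `ℓ` (`GenusExact.eq_of_natCast_mem_of_zhangKolyvaginPrime`). [cite: GrossLMS1991, §3] [cite: WZhang2014, Notations (xii)] -/
theorem smul_place_eq_of_zhangKolyvaginPrime {N p ℓ : ℕ} (hℓ : Zhang2014.IsKolyvaginPrime N W K p ℓ) (τ : K ≃ₐ[ℚ] K)
    {w : HeightOneSpectrum (𝓞 K)} (hw : (ℓ : 𝓞 K) ∈ w.asIdeal) : τ • w = w := by
  have hτℓ : τ • ((ℓ : ℕ) : 𝓞 K) = ℓ := by
    rw [← MulSemiringAction.toRingHom_apply, map_natCast]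
  have h : (ℓ : 𝓞 K) ∈ (τ • w).asIdeal := by
    have h' := (HeightOneSpectrum.smul_mem_smul_asIdeal_iff τ w ((ℓ : ℕ) : 𝓞 K)).mpr hw
    rwa [hτℓ] at h'
  exact eq_of_natCast_mem_of_zhangKolyvaginPrime hℓ hw h

/-! ## §3 Kolyvagin's two-term identity at `p = 2` over `K` -/

/-- **KOLYVAGIN'S TWO-TERM IDENTITY at `p = 2` over the Heegner field** (Kolyvagin-datum currency; see the module docstring for the
frame and the reading).  For the swap `ℓ₀ ↦ ℓ′`: `x = c_M(nℓ′)`, `y = c_M(nℓ₀)` of the SAME `τ`-sign `ε`, with local exponents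
`A′, B′` at `λ′ ∋ ℓ′` and `A₀, B₀` at `λ₀ ∋ ℓ₀` (zero-threshold of the Kummer class, Kummer-threshold of the other one):
`M + 2 ≤ A′ + B′ ⟹ A′ + B′ = A₀ + B₀`.  [cite: Kolyvagin1991MathAnn, Thm. 2.1] [cite: McCallumLMS1991, §5 Lemma 5.3 and (13)]
[cite: GrossLMS1991, Prop. 6.2 (1)] [cite: MilneADT2006, Ch. I, Thm. 4.10(b)] -/
theorem exponent_add_eq_of_kolyvagin_twoTerm
    (hsurj : ∀ k : ℕ, W.HasSurjectiveModNGaloisRep ((2 ^ k : ℕ) : ℤ)) (hc : Odd W.tamagawaProduct)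
    (hK : IsImaginaryQuadratic K) (hD : NumberField.discr K < -4) (hΔ : W.Δ < 0)
    (hH : SatisfiesHeegnerHypothesis (W.conductorNorm ℤ) K)
    (Dt : ModularParametrizationData W (W.conductorNorm ℤ)) (β : ℤ) (ι : K →+* ℂ)
    [∀ j : ℕ, NumberField (ringClassField K ι j)] {M : ℕ} (hM : 1 ≤ M)
    {τ : K ≃ₐ[ℚ] K} (hτ1 : τ ≠ 1) (hττ : τ * τ = 1)
    {n ℓ' ℓ₀ : ℕ} (hℓ'p : ℓ'.Prime) (hℓ₀p : ℓ₀.Prime) (hne : ℓ' ≠ ℓ₀)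
    (hc' : KolyvaginDescent.KolSupp (Zhang2014.IsKolyvaginPrime (W.conductorNorm ℤ) W K 2) (n * ℓ'))
    (hc₀ : KolyvaginDescent.KolSupp (Zhang2014.IsKolyvaginPrime (W.conductorNorm ℤ) W K 2) (n * ℓ₀))
    (hc'M : ∀ q ∈ (n * ℓ').primeFactors, M + 1 ≤ Zhang2014.kolyvaginIndex W 2 q)
    (hc₀M : ∀ q ∈ (n * ℓ₀).primeFactors, M + 1 ≤ Zhang2014.kolyvaginIndex W 2 q)
    (hF' : FrobEqFrobInfty W K (2 ^ M) ℓ') (hF₀ : FrobEqFrobInfty W K (2 ^ M) ℓ₀)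
    (d' : KolyvaginHeegnerData Dt β ι (n * ℓ')) (d₀ : KolyvaginHeegnerData Dt β ι (n * ℓ₀))
    (w' w₀ : HeightOneSpectrum (𝓞 K)) (hw' : (ℓ' : 𝓞 K) ∈ w'.asIdeal) (hw₀ : (ℓ₀ : 𝓞 K) ∈ w₀.asIdeal)
    {ε : ℤ} (hε : ε = 1 ∨ ε = -1)
    (hx : conjAct W τ ((2 ^ M : ℕ) : ℤ) (d'.kolyvaginClass Nat.prime_two M) = ε • d'.kolyvaginClass Nat.prime_two M)
    (hy : conjAct W τ ((2 ^ M : ℕ) : ℤ) (d₀.kolyvaginClass Nat.prime_two M) = ε • d₀.kolyvaginClass Nat.prime_two M)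
    {A' B' A₀ B₀ : ℕ}
    (hA' : ∀ j : ℕ, (2 ^ j) • galoisCohomology.localization ((W.baseChange K).torsionGaloisModule ((2 ^ M : ℕ) : ℤ))
      (Sum.inr w' : Place K) 1 (d₀.kolyvaginClass Nat.prime_two M) = 0 ↔ A' ≤ j)
    (hB' : ∀ j : ℕ, (2 ^ j) • galoisCohomology.localization ((W.baseChange K).torsionGaloisModule ((2 ^ M : ℕ) : ℤ))
      (Sum.inr w' : Place K) 1 (d'.kolyvaginClass Nat.prime_two M) ∈
        (W.baseChange K).kummerSelmerStructure ((2 ^ M : ℕ) : ℤ) (Sum.inr w') ↔ B' ≤ j)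
    (hA₀ : ∀ j : ℕ, (2 ^ j) • galoisCohomology.localization ((W.baseChange K).torsionGaloisModule ((2 ^ M : ℕ) : ℤ))
      (Sum.inr w₀ : Place K) 1 (d'.kolyvaginClass Nat.prime_two M) = 0 ↔ A₀ ≤ j)
    (hB₀ : ∀ j : ℕ, (2 ^ j) • galoisCohomology.localization ((W.baseChange K).torsionGaloisModule ((2 ^ M : ℕ) : ℤ))
      (Sum.inr w₀ : Place K) 1 (d₀.kolyvaginClass Nat.prime_two M) ∈
        (W.baseChange K).kummerSelmerStructure ((2 ^ M : ℕ) : ℤ) (Sum.inr w₀) ↔ B₀ ≤ j)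
    (hguard : M + 2 ≤ A' + B') :
    A' + B' = A₀ + B₀ := by
  haveI : Fact (Nat.Prime 2) := ⟨Nat.prime_two⟩
  have hD3 : NumberField.discr K ≠ -3 := by omega
  have hD4 : NumberField.discr K ≠ -4 := by omega
  -- ### numerics of the two conductors
  have hn0 : n ≠ 0 := by
    rintro rfl
    exact hc'.1.ne_zero (zero_mul _)
  have hℓ'c' : ℓ' ∈ (n * ℓ').primeFactors :=
    Nat.mem_primeFactors.mpr ⟨hℓ'p, dvd_mul_left _ _, mul_ne_zero hn0 hℓ'p.ne_zero⟩
  have hℓ₀c₀ : ℓ₀ ∈ (n * ℓ₀).primeFactors :=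
    Nat.mem_primeFactors.mpr ⟨hℓ₀p, dvd_mul_left _ _, mul_ne_zero hn0 hℓ₀p.ne_zero⟩
  have hℓ' : Zhang2014.IsKolyvaginPrime (W.conductorNorm ℤ) W K 2 ℓ' := hc'.2 ℓ' hℓ'c'
  have hℓ₀ : Zhang2014.IsKolyvaginPrime (W.conductorNorm ℤ) W K 2 ℓ₀ := hc₀.2 ℓ₀ hℓ₀c₀
  have hk' : M ≤ Zhang2014.kolyvaginIndex W 2 ℓ' := by have h := hc'M ℓ' hℓ'c'; omega
  have hk₀ : M ≤ Zhang2014.kolyvaginIndex W 2 ℓ₀ := by have h := hc₀M ℓ₀ hℓ₀c₀; omega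
  have hk'all : ∀ q ∈ (n * ℓ').primeFactors,
      Zhang2014.IsKolyvaginPrime (W.conductorNorm ℤ) W K 2 q ∧ M ≤ Zhang2014.kolyvaginIndex W 2 q :=
    fun q hq ↦ ⟨hc'.2 q hq, by have h := hc'M q hq; omega⟩
  have hk₀all : ∀ q ∈ (n * ℓ₀).primeFactors,
      Zhang2014.IsKolyvaginPrime (W.conductorNorm ℤ) W K 2 q ∧ M ≤ Zhang2014.kolyvaginIndex W 2 q :=
    fun q hq ↦ ⟨hc₀.2 q hq, by have h := hc₀M q hq; omega⟩
  have hℓ'n : ¬ ℓ' ∣ n := by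
    rintro ⟨m, rfl⟩
    exact hℓ'p.one_lt.ne' (Nat.isUnit_iff.mp (hc'.1 ℓ' ⟨m, by ring⟩))
  have hℓ₀n : ¬ ℓ₀ ∣ n := by
    rintro ⟨m, rfl⟩
    exact hℓ₀p.one_lt.ne' (Nat.isUnit_iff.mp (hc₀.1 ℓ₀ ⟨m, by ring⟩))
  -- ### the places: `λ′`, `λ₀` are the unique places above `ℓ′`, `ℓ₀`; a place above `n` is neither
  have hnw' : (n : 𝓞 K) ∉ w'.asIdeal := fun h ↦ by
    obtain ⟨q, hq, hqw⟩ := (natCast_mem_iff_exists_primeFactor_mem hn0 w').mp h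
    have hqℓ : q = ℓ' := JET.Walk.prime_eq_of_natCast_mem w' (Nat.prime_of_mem_primeFactors hq) hℓ'p hqw hw'
    exact hℓ'n (hqℓ ▸ Nat.dvd_of_mem_primeFactors hq)
  have hnw₀ : (n : 𝓞 K) ∉ w₀.asIdeal := fun h ↦ by
    obtain ⟨q, hq, hqw⟩ := (natCast_mem_iff_exists_primeFactor_mem hn0 w₀).mp h
    have hqℓ : q = ℓ₀ := JET.Walk.prime_eq_of_natCast_mem w₀ (Nat.prime_of_mem_primeFactors hq) hℓ₀p hqw hw₀
    exact hℓ₀n (hqℓ ▸ Nat.dvd_of_mem_primeFactors hq)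
  have hℓ₀w' : (ℓ₀ : 𝓞 K) ∉ w'.asIdeal := fun h ↦ hne (JET.Walk.prime_eq_of_natCast_mem w' hℓ'p hℓ₀p hw' h)
  have hℓ'w₀ : (ℓ' : 𝓞 K) ∉ w₀.asIdeal := fun h ↦ hne (JET.Walk.prime_eq_of_natCast_mem w₀ hℓ'p hℓ₀p h hw₀)
  have hw'w₀ : w' ≠ w₀ := fun h ↦ hℓ'w₀ (h ▸ hw')
  have hc₀w' : ((n * ℓ₀ : ℕ) : 𝓞 K) ∉ w'.asIdeal := fun h ↦ by
    rw [Nat.cast_mul] at h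
    rcases w'.isPrime.mem_or_mem h with h | h
    · exact hnw' h
    · exact hℓ₀w' h
  have hc'w₀ : ((n * ℓ' : ℕ) : 𝓞 K) ∉ w₀.asIdeal := fun h ↦ by
    rw [Nat.cast_mul] at h
    rcases w₀.isPrime.mem_or_mem h with h | h
    · exact hnw₀ h
    · exact hℓ'w₀ h
  have hfix' : τ • w' = w' := smul_place_eq_of_zhangKolyvaginPrime W K hℓ' τ hw'
  have hfix₀ : τ • w₀ = w₀ := smul_place_eq_of_zhangKolyvaginPrime W K hℓ₀ τ hw₀
  -- ### the exceptional set `T = {λ′, λ₀} ∪ t`, `t` = the places over `n`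
  set t : Finset (Place K) := (placesDividing K n).image Sum.inr with htdef
  have hmemt : ∀ v : HeightOneSpectrum (𝓞 K), (Sum.inr v : Place K) ∈ t ↔ (n : 𝓞 K) ∈ v.asIdeal := by
    intro v
    rw [htdef, Finset.mem_image]
    constructor
    · rintro ⟨u, hu, huv⟩
      rw [Sum.inr_injective huv] at hu
      exact (mem_placesDividing_iff_natCast_mem hn0 v).mp hu
    · intro hv
      exact ⟨v, (mem_placesDividing_iff_natCast_mem hn0 v).mpr hv, rfl⟩
  have hl' : (Sum.inr w' : Place K) ∉ t := fun h ↦ hnw' ((hmemt w').mp h)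
  have hl₀ : (Sum.inr w₀ : Place K) ∉ t := fun h ↦ hnw₀ ((hmemt w₀).mp h)
  have hne' : (Sum.inr w' : Place K) ≠ Sum.inr w₀ := fun h ↦ hw'w₀ (Sum.inr_injective h)
  -- ### Kummer off `T`
  have hxT : d'.kolyvaginClass Nat.prime_two M ∈
      kummerOutside (W.baseChange K) (2 ^ M) (insert (Sum.inr w') (insert (Sum.inr w₀) t)) := by
    refine kolyvaginClass_two_mem_kummerOutside W K hsurj hc hK hD3 hD4 hH Dt β ι M hc'.1 hk'all d' _ fun v hv ↦ ?_
    rw [Nat.cast_mul] at hv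
    rcases v.isPrime.mem_or_mem hv with h | h
    · exact Finset.mem_insert_of_mem (Finset.mem_insert_of_mem ((hmemt v).mpr h))
    · rw [eq_of_natCast_mem_of_zhangKolyvaginPrime hℓ' hw' h]
      exact Finset.mem_insert_self _ _
  have hyT : d₀.kolyvaginClass Nat.prime_two M ∈
      kummerOutside (W.baseChange K) (2 ^ M) (insert (Sum.inr w') (insert (Sum.inr w₀) t)) := by
    refine kolyvaginClass_two_mem_kummerOutside W K hsurj hc hK hD3 hD4 hH Dt β ι M hc₀.1 hk₀all d₀ _ fun v hv ↦ ?_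
    rw [Nat.cast_mul] at hv
    rcases v.isPrime.mem_or_mem hv with h | h
    · exact Finset.mem_insert_of_mem (Finset.mem_insert_of_mem ((hmemt v).mpr h))
    · rw [eq_of_natCast_mem_of_zhangKolyvaginPrime hℓ₀ hw₀ h]
      exact Finset.mem_insert_of_mem (Finset.mem_insert_self _ _)
  -- Kummer membership of the "other" class at each surviving place
  have hyS' := localization_kolyvaginClass_two_mem_kummerSelmerStructure W K hsurj hc hK hD3 hD4 hH Dt β ι M hc₀.1 hk₀all
    d₀ w' hc₀w'
  have hxS₀ := localization_kolyvaginClass_two_mem_kummerSelmerStructure W K hsurj hc hK hD3 hD4 hH Dt β ι M hc'.1 hk'all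
    d' w₀ hc'w₀
  -- ### the Weil datum and THE canonical invariant family
  obtain ⟨e, hμ, hadd₁, hadd₂, halt, hnondeg, hgal, hlift⟩ :=
    exists_weilPairing_liftEquivariant W K (2 ^ M) (le_trans (by norm_num) (Nat.pow_le_pow_right (by norm_num) hM))
  have hinj : ∀ v : HeightOneSpectrum (𝓞 K), Injective (LocalInvariants.canonical K (2 ^ M) (Sum.inr v)) :=
    fun v ↦ ((LocalInvariants.canonical_isPerfect (K := K) (n := 2 ^ M)) v).1.1
  have hinvc : (LocalInvariants.canonical K (2 ^ M)).IsConjCompatible τ := isConjCompatible_canonical τ (2 ^ M)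
  have hte' : ∀ S T, e ((isLiftOfAut_liftAutPlace τ hfix').torsionMap W ((2 ^ M : ℕ) : ℤ) S)
      ((isLiftOfAut_liftAutPlace τ hfix').torsionMap W ((2 ^ M : ℕ) : ℤ) T) = liftAutPlace τ hfix' (e S T) :=
    fun S T ↦ (hlift τ _ (isLiftOfAut_liftAutPlace τ hfix') S T).symm
  have hte₀ : ∀ S T, e ((isLiftOfAut_liftAutPlace τ hfix₀).torsionMap W ((2 ^ M : ℕ) : ℤ) S)
      ((isLiftOfAut_liftAutPlace τ hfix₀).torsionMap W ((2 ^ M : ℕ) : ℤ) T) = liftAutPlace τ hfix₀ (e S T) :=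
    fun S T ↦ (hlift τ _ (isLiftOfAut_liftAutPlace τ hfix₀) S T).symm
  -- ### the common own primes contribute nothing
  have ht : ∀ u ∈ t, invWeilPairing (W.baseChange K) (2 ^ M) e hμ hadd₁ hadd₂ hgal (LocalInvariants.canonical K (2 ^ M)) u
      (galoisCohomology.localization ((W.baseChange K).torsionGaloisModule ((2 ^ M : ℕ) : ℤ)) u 1
        (d'.kolyvaginClass Nat.prime_two M))
      (galoisCohomology.localization ((W.baseChange K).torsionGaloisModule ((2 ^ M : ℕ) : ℤ)) u 1
        (d₀.kolyvaginClass Nat.prime_two M)) = 0 := by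
    intro u hu
    rw [htdef, Finset.mem_image] at hu
    obtain ⟨v, hv, rfl⟩ := hu
    obtain ⟨q, hq, hqv⟩ :=
      (natCast_mem_iff_exists_primeFactor_mem hn0 v).mp ((mem_placesDividing_iff_natCast_mem hn0 v).mp hv)
    obtain ⟨hqp, hqn, -⟩ := Nat.mem_primeFactors.mp hq
    exact invWeilPairing_localization_kolyvaginClass_eq_zero_of_common_prime W K hK hD Dt β ι M d' d₀ hc' hc₀ hc'M hc₀M
      (Nat.mem_primeFactors.mpr ⟨hqp, hqn.mul_right _, mul_ne_zero hn0 hℓ'p.ne_zero⟩)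
      (Nat.mem_primeFactors.mpr ⟨hqp, hqn.mul_right _, mul_ne_zero hn0 hℓ₀p.ne_zero⟩) v hqv e hμ hadd₁ hadd₂ hgal
      (LocalInvariants.canonical K (2 ^ M))
  -- ### the two surviving terms: one bit lost each
  have h' : addOrderOf (invWeilPairing (W.baseChange K) (2 ^ M) e hμ hadd₁ hadd₂ hgal (LocalInvariants.canonical K (2 ^ M))
      (Sum.inr w')
      (galoisCohomology.localization ((W.baseChange K).torsionGaloisModule ((2 ^ M : ℕ) : ℤ)) (Sum.inr w' : Place K) 1
        (d'.kolyvaginClass Nat.prime_two M))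
      (galoisCohomology.localization ((W.baseChange K).torsionGaloisModule ((2 ^ M : ℕ) : ℤ)) (Sum.inr w' : Place K) 1
        (d₀.kolyvaginClass Nat.prime_two M))) = 2 ^ (A' + B' - (M + 1)) := by
    rw [invWeilPairing_comm (W.baseChange K) M e hμ hadd₁ hadd₂ hgal halt w' (LocalInvariants.canonical K (2 ^ M))]
    exact addOrderOf_invWeilPairing_localization_eq_of_same_sign W K hK hΔ hM hℓ' hk' hF' w' hw' hτ1 hττ hfix' e hμ hadd₁
      hadd₂ hgal halt hnondeg hte' (LocalInvariants.canonical K (2 ^ M)) (hinj w') hinvc hε hy hx hyS' hA' hB'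
  have h₀ : addOrderOf (invWeilPairing (W.baseChange K) (2 ^ M) e hμ hadd₁ hadd₂ hgal (LocalInvariants.canonical K (2 ^ M))
      (Sum.inr w₀)
      (galoisCohomology.localization ((W.baseChange K).torsionGaloisModule ((2 ^ M : ℕ) : ℤ)) (Sum.inr w₀ : Place K) 1
        (d'.kolyvaginClass Nat.prime_two M))
      (galoisCohomology.localization ((W.baseChange K).torsionGaloisModule ((2 ^ M : ℕ) : ℤ)) (Sum.inr w₀ : Place K) 1
        (d₀.kolyvaginClass Nat.prime_two M))) = 2 ^ (A₀ + B₀ - (M + 1)) :=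
    addOrderOf_invWeilPairing_localization_eq_of_same_sign W K hK hΔ hM hℓ₀ hk₀ hF₀ w₀ hw₀ hτ1 hττ hfix₀ e hμ hadd₁
      hadd₂ hgal halt hnondeg hte₀ (LocalInvariants.canonical K (2 ^ M)) (hinj w₀) hinvc hε hx hy hxS₀ hA₀ hB₀
  -- ### reciprocity: the two exponents agree
  exact exponent_eq_of_twoTerm_canonical (W.baseChange K) (2 ^ M) e hμ hadd₁ hadd₂ hgal halt t (Sum.inr w') (Sum.inr w₀)
    hl' hl₀ hne' hxT hyT ht h' h₀ hguard

/-! ## §4 The same in Q2's currency (`torsionLocalKer` / `selmerLocalKer` thresholds of the GLOBAL classes) -/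

omit [W.IsGloballyMinimal] [NeZero (W.conductorNorm ℤ)] in
/-- Dictionary: `2^j • c ∈ torsionLocalKer_v ⟺ 2^j • loc_v c = 0` (strict vanishing = kernel of the genuine localisation,
tree `mem_torsionLocalKer_iff_res_eq_zero`). [cite: McCallumLMS1991, §3 (3)] [cite: SilvermanAEC2009, Cor. III.6.4(b)] -/
theorem pow_zsmul_mem_torsionLocalKer_iff (M : ℕ) (v : HeightOneSpectrum (𝓞 K))
    (c : galH1Torsion (W.baseChange K) ((2 ^ M : ℕ) : ℤ)) (j : ℕ) :
    ((2 ^ j : ℕ) : ℤ) • c ∈ (W.baseChange K).torsionLocalKer (v.adicCompletion K) ((2 ^ M : ℕ) : ℤ) ↔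
      (2 ^ j) • galoisCohomology.localization ((W.baseChange K).torsionGaloisModule ((2 ^ M : ℕ) : ℤ))
        (Sum.inr v : Place K) 1 c = 0 := by
  -- (adapted from LEAD's `BottomRungNewPrime.addOrderOf_localization_eq_two_pow`)
  haveI : CharZero (v.adicCompletion K) :=
    charZero_of_injective_algebraMap (algebraMap K (v.adicCompletion K)).injective
  rw [← natCast_zsmul, ← map_zsmul]
  refine (mem_torsionLocalKer_iff_res_eq_zero (W.baseChange K) (v.adicCompletion K) (k := 2 ^ M)
    (pow_ne_zero M two_ne_zero) _).trans ?_
  exact Iff.rfl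

omit [W.IsElliptic] [W.IsGloballyMinimal] [NeZero (W.conductorNorm ℤ)] in
/-- Dictionary: `2^j • c ∈ selmerLocalKer_v ⟺ 2^j • loc_v c ∈ 𝓛_v` (the Kummer condition of the Selmer structure,
tree `comap_localization_kummerSelmerStructure`). [cite: SilvermanAEC2009, X.§4] -/
theorem pow_zsmul_mem_selmerLocalKer_iff (M : ℕ) (v : HeightOneSpectrum (𝓞 K))
    (c : galH1Torsion (W.baseChange K) ((2 ^ M : ℕ) : ℤ)) (j : ℕ) :
    ((2 ^ j : ℕ) : ℤ) • c ∈ selmerLocalKer (W.baseChange K) (v.adicCompletion K) ((2 ^ M : ℕ) : ℤ) ↔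
      (2 ^ j) • galoisCohomology.localization ((W.baseChange K).torsionGaloisModule ((2 ^ M : ℕ) : ℤ))
        (Sum.inr v : Place K) 1 c ∈ (W.baseChange K).kummerSelmerStructure ((2 ^ M : ℕ) : ℤ) (Sum.inr v) := by
  rw [← natCast_zsmul, ← map_zsmul]
  exact ((SetLike.ext_iff.mp
    ((W.baseChange K).comap_localization_kummerSelmerStructure ((2 ^ M : ℕ) : ℤ) (Sum.inr v : Place K)) _).symm.trans
      AddSubgroup.mem_comap)

/-- **KOLYVAGIN'S TWO-TERM IDENTITY at `p = 2` over `K`, Q2's currency**: the four exponents as thresholds of the GLOBAL classes in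
`torsionLocalKer` (the DROPS' `d_T(ℓ) = M −` this, for the class that is Kummer at the place) and `selmerLocalKer` (for the class whose
own prime it is — the left clause of Q2 `KolyvaginRelationAtTwo`, which then equates it with the `torsionLocalKer`-threshold of `c_M(n)`).
[cite: Kolyvagin1991MathAnn, Thm. 2.1] [cite: McCallumLMS1991, §4 Prop. 4.4, §5 (13)] -/
theorem exponent_add_eq_of_kolyvagin_twoTerm_localKer
    (hsurj : ∀ k : ℕ, W.HasSurjectiveModNGaloisRep ((2 ^ k : ℕ) : ℤ)) (hc : Odd W.tamagawaProduct)
    (hK : IsImaginaryQuadratic K) (hD : NumberField.discr K < -4) (hΔ : W.Δ < 0)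
    (hH : SatisfiesHeegnerHypothesis (W.conductorNorm ℤ) K)
    (Dt : ModularParametrizationData W (W.conductorNorm ℤ)) (β : ℤ) (ι : K →+* ℂ)
    [∀ j : ℕ, NumberField (ringClassField K ι j)] {M : ℕ} (hM : 1 ≤ M)
    {τ : K ≃ₐ[ℚ] K} (hτ1 : τ ≠ 1) (hττ : τ * τ = 1)
    {n ℓ' ℓ₀ : ℕ} (hℓ'p : ℓ'.Prime) (hℓ₀p : ℓ₀.Prime) (hne : ℓ' ≠ ℓ₀)
    (hc' : KolyvaginDescent.KolSupp (Zhang2014.IsKolyvaginPrime (W.conductorNorm ℤ) W K 2) (n * ℓ'))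
    (hc₀ : KolyvaginDescent.KolSupp (Zhang2014.IsKolyvaginPrime (W.conductorNorm ℤ) W K 2) (n * ℓ₀))
    (hc'M : ∀ q ∈ (n * ℓ').primeFactors, M + 1 ≤ Zhang2014.kolyvaginIndex W 2 q)
    (hc₀M : ∀ q ∈ (n * ℓ₀).primeFactors, M + 1 ≤ Zhang2014.kolyvaginIndex W 2 q)
    (hF' : FrobEqFrobInfty W K (2 ^ M) ℓ') (hF₀ : FrobEqFrobInfty W K (2 ^ M) ℓ₀)
    (d' : KolyvaginHeegnerData Dt β ι (n * ℓ')) (d₀ : KolyvaginHeegnerData Dt β ι (n * ℓ₀))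
    (w' w₀ : HeightOneSpectrum (𝓞 K)) (hw' : (ℓ' : 𝓞 K) ∈ w'.asIdeal) (hw₀ : (ℓ₀ : 𝓞 K) ∈ w₀.asIdeal)
    {ε : ℤ} (hε : ε = 1 ∨ ε = -1)
    (hx : conjAct W τ ((2 ^ M : ℕ) : ℤ) (d'.kolyvaginClass Nat.prime_two M) = ε • d'.kolyvaginClass Nat.prime_two M)
    (hy : conjAct W τ ((2 ^ M : ℕ) : ℤ) (d₀.kolyvaginClass Nat.prime_two M) = ε • d₀.kolyvaginClass Nat.prime_two M)
    {A' B' A₀ B₀ : ℕ}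
    (hA' : ∀ j : ℕ, ((2 ^ j : ℕ) : ℤ) • d₀.kolyvaginClass Nat.prime_two M ∈
      (W.baseChange K).torsionLocalKer (w'.adicCompletion K) ((2 ^ M : ℕ) : ℤ) ↔ A' ≤ j)
    (hB' : ∀ j : ℕ, ((2 ^ j : ℕ) : ℤ) • d'.kolyvaginClass Nat.prime_two M ∈
      selmerLocalKer (W.baseChange K) (w'.adicCompletion K) ((2 ^ M : ℕ) : ℤ) ↔ B' ≤ j)
    (hA₀ : ∀ j : ℕ, ((2 ^ j : ℕ) : ℤ) • d'.kolyvaginClass Nat.prime_two M ∈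
      (W.baseChange K).torsionLocalKer (w₀.adicCompletion K) ((2 ^ M : ℕ) : ℤ) ↔ A₀ ≤ j)
    (hB₀ : ∀ j : ℕ, ((2 ^ j : ℕ) : ℤ) • d₀.kolyvaginClass Nat.prime_two M ∈
      selmerLocalKer (W.baseChange K) (w₀.adicCompletion K) ((2 ^ M : ℕ) : ℤ) ↔ B₀ ≤ j)
    (hguard : M + 2 ≤ A' + B') :
    A' + B' = A₀ + B₀ :=
  exponent_add_eq_of_kolyvagin_twoTerm W K hsurj hc hK hD hΔ hH Dt β ι hM hτ1 hττ hℓ'p hℓ₀p hne hc' hc₀ hc'M hc₀M hF' hF₀ d' d₀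
    w' w₀ hw' hw₀ hε hx hy
    (fun j ↦ (pow_zsmul_mem_torsionLocalKer_iff W K M w' _ j).symm.trans (hA' j))
    (fun j ↦ (pow_zsmul_mem_selmerLocalKer_iff W K M w' _ j).symm.trans (hB' j))
    (fun j ↦ (pow_zsmul_mem_torsionLocalKer_iff W K M w₀ _ j).symm.trans (hA₀ j))
    (fun j ↦ (pow_zsmul_mem_selmerLocalKer_iff W K M w₀ _ j).symm.trans (hB₀ j)) hguard

end Summit.BirchSwinnertonDyer.BirchSwinnertonDyer.Theorems.GenusExact.PlusDescent

end
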